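import Summits.QuantumFields.QCD.Theses.NestedDissectionSea
import Literature.MathematicalPhysics.QuantumFieldTheory.QCD
import Literature.MathematicalPhysics.QuantumFieldTheory.WilsonFlow
import Literature.MathematicalPhysics.QuantumLattice.WilsonCellSchur
import Literature.MathematicalPhysics.QuantumLattice.GrassmannIntegralWilsonProofs
import Literature.MathematicalPhysics.QuantumLattice.AdaptiveCoarseSystem
import Summits.QuantumFields.QCD.Theorems.TipNoBinding.Negative.FreeSpectrum

/-!
# Crux `NegativeCellsDilute` (stmt-QuantumFields-13900), negative side — line
# `price-the-seed-not-the-spot`, stub `stub_seedActionFloor`: NO ZERO-MODE ACTION FLOOR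

Support file for the crux `Summit.QuantumFields.QCD.Theses.NestedDissectionSea.NegativeCellsDilute`
(route `NestedDissectionSea`), companion of `CellPositivity.lean` / `PinWindow.lean` /
`StripLawForallEtaFalse.lean`.  The checked skeleton of the line `price-the-seed-not-the-spot`
registers the deterministic stub `stub_seedActionFloor` (S′): floors `A₀ > 16π²/9`, `η₀ > 0`, `ρ₀ > 0`
such that for every `SU(3)` field `U` on a four-torus of side `N > 8ρ`, every scale `ρ ≥ ρ₀` and every
sub-box `(x, r)` with `ρ/2 ≤ r_i ≤ ρ`, a spinor `ψ ≠ 0` on the box with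
`‖(C − Cᴴ)ψ‖² ≤ (2η₀/ρ)²‖ψ‖²`, `C = wilsonCell (wilsonFlow (ρ²/8) U) 0 x r` the massless Dirichlet
Wilson cell of the FLOWED field, forces flowed plaquette action `≥ A₀` in the concentric `5ρ`-box.

This file proves, sorry-free and on the standard axioms, that the stub is FALSE as registered
(`not_seedActionFloor`, verbatim negation; parametric form `seedActionFloor_false_at`: it fails for
EVERY `A₀ > 0`, every `η₀` and every `ρ₀`).  Witness: the flat field `U = 1` on the torus of side
`8ρ + 1`, `ρ = 2(⌈ρ₀⌉₊ + 1)` (even), `x = 0`, `r ≡ ρ`, and the STAGGERED DOUBLER VECTOR `ψ` — `1` on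
the sites of the open box all of whose coordinates are odd, colour `0`, spin `0`:
* `wilsonFlow_one` — the flat field is stationary under the Wilson flow (tree
  `wilsonFlow_eq_self_of_flat`), and `actionDensity_one` — its plaquette action density is
  `3 − Re tr 1 = 0`, so the conclusion would read `A₀ ≤ 0`;
* `cell_sub_conjTranspose_mulVec` — on box-supported vectors the anti-Hermitian part `C − Cᴴ` of a
  Dirichlet cell acts as the anti-Hermitian part `D − Dᴴ` of the whole-torus Wilson–Dirac matrix;
* `free_sub_conjTranspose_mulVec_eq_zero` — for the flat field, by γ₅-hermiticity `Dᴴ = Γ₅ D Γ₅`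
  (tree `wilsonDirac_gammaFive_hermitian_holds`) and the free action `wilsonDirac_one_mulVec_apply`
  (`TipNoBinding/Negative/FreeSpectrum`), `(D − Dᴴ)φ` vanishes at every index around which the
  spin-`0` vector `φ` is parity-balanced (`φ(p − e_μ) = φ(p + e_μ)` for all `μ`): only the NAIVE part
  `Σ_μ γ_μ ⊗ (T⁺_μ − T⁻_μ)` of `D_W` survives in `D − Dᴴ`, the Wilson term and the mass cancel;
* `oddSite_shift_iff` — the parity lemma: inside an EVEN box the backward and forward neighbours of
  a box site are simultaneously all-odd box sites or not (an even coordinate `v ∈ (0, ρ)` has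
  `2 ≤ v ≤ ρ − 2`), so the staggered vector is parity-balanced at every box index;
* `seed_one` — hence `(C − Cᴴ)ψ = 0` exactly: the flat field is a seed at every tolerance.

Moral for the line: the seed predicate "approximate kernel vector of the naive part `C − Cᴴ`" does
not see the Wilson term that lifts the doublers, so it is satisfied by the zero-action vacuum; an
action floor needs a seed notion involving the full cell (e.g. a near-kernel vector of `C` itself, or
of `Cᴴ C`), not of its anti-Hermitian part alone.  Standard material [folklore]; no new definitions.
-/

noncomputable section

namespace Summit.QuantumFields.QCD.Theorems.NegativeCellsDiluteSeedActionFloorFalse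

open scoped BigOperators Classical Matrix
open Matrix
open Literature.MathematicalPhysics.QuantumLattice Literature.MathematicalPhysics.QuantumFieldTheory
  Literature.Probability.LatticeModels
open Summit.QuantumFields.QCD.Theorems.TipNoBindingNegative
  (wilsonDirac_one_mulVec_apply sum_projMinus_add_projPlus)

variable {N : ℕ} [NeZero N]

/-! ### The flat field: trivial holonomies, stationary under the flow, zero action -/

omit [NeZero N] in
/-- Every plaquette holonomy of the flat configuration `U = 1` is trivial. -/
theorem plaquetteHolonomy_one (y : TorusSite 4 N) (μ ν : Fin 4) :
    plaquetteHolonomy (1 : GaugeConfig 4 N SU3) y μ ν = 1 := by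
  simp [plaquetteHolonomy]

/-- The flat configuration is stationary under the Wilson flow (tree `wilsonFlow_eq_self_of_flat`). -/
theorem wilsonFlow_one (t : ℝ) : wilsonFlow t (1 : GaugeConfig 4 N SU3) = 1 :=
  wilsonFlow_eq_self_of_flat (fun y μ ν _ => plaquetteHolonomy_one y μ ν) t

omit [NeZero N] in
/-- The flat configuration has zero plaquette action density: `Re tr (1 - U_p) = 3 - 3 = 0`. -/
theorem actionDensity_one (y : TorusSite 4 N) (μ ν : Fin 4) :
    (3 - ((fundamentalRep (Fin 3) (plaquetteHolonomy (1 : GaugeConfig 4 N SU3) y μ ν)).trace).re) = 0 := by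
  rw [plaquetteHolonomy_one, map_one, Matrix.trace_one, Fintype.card_fin]
  simp

/-! ### Dirichlet cells: `C - Cᴴ` acts on box-supported vectors as `D - Dᴴ` -/

/-- For a vector `φ` on the whole torus supported inside the box `(x, s)`, the anti-Hermitian part
`C - Cᴴ` of the Dirichlet cell `C = wilsonCell U m x s` acts on the restriction of `φ` as the
anti-Hermitian part `D - Dᴴ` of the whole-torus Wilson–Dirac matrix acts on `φ` (principal blocks
commute with `ᴴ`, and the omitted columns meet `φ = 0`). -/
theorem cell_sub_conjTranspose_mulVec (U : GaugeConfig 4 N SU3) (m : ℝ) (x : TorusSite 4 N)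
    (s : Fin 4 → ℕ) (φ : TorusSite 4 N × Fin 3 × Fin 4 → ℂ)
    (hφ : ∀ q, ¬ wilsonBox x s q → φ q = 0) (p : {p // wilsonBox x s p}) :
    ((wilsonCell U m x s - (wilsonCell U m x s)ᴴ) *ᵥ fun q => φ q.1) p =
      ((wilsonDirac (fundamentalRep (Fin 3)) U m 1 -
        (wilsonDirac (fundamentalRep (Fin 3)) U m 1)ᴴ) *ᵥ φ) p.1 := by
  simp only [Matrix.mulVec, dotProduct, Matrix.sub_apply, Matrix.conjTranspose_apply, wilsonCell,
    Matrix.toSquareBlockProp_def]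
  symm
  calc ∑ q, (wilsonDirac (fundamentalRep (Fin 3)) U m 1 p.1 q -
          star (wilsonDirac (fundamentalRep (Fin 3)) U m 1 q p.1)) * φ q
      = ∑ q ∈ Finset.univ.filter (wilsonBox x s), (wilsonDirac (fundamentalRep (Fin 3)) U m 1 p.1 q -
          star (wilsonDirac (fundamentalRep (Fin 3)) U m 1 q p.1)) * φ q := by
        refine (Finset.sum_subset (Finset.filter_subset _ _) fun q _ hq => ?_).symm
        rw [hφ q (by simpa using hq), mul_zero]
    _ = _ := Finset.sum_subtype _ (by simp) _

/-! ### The free Wilson–Dirac operator: its naive part kills parity-balanced spin-`0` vectors -/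

/-- **The naive part of the free Wilson–Dirac matrix at a parity-balanced index.**  For the flat
field, `Dᴴ = Γ₅ D Γ₅` (γ₅-hermiticity), so on a positive-chirality vector `φ` (supported on spin
component `0`) `(D - Dᴴ)φ = (1 - Γ₅)(Dφ)`; and at an index `p` around which `φ` takes the same values
one step backward and one step forward in every direction, the Wilson and naive hops of `(Dφ)(p)`
combine to `4 φ(p) - Σ_μ φ(p + e_μ)` at the spin of `p`, which vanishes unless that spin is `0`,
where `1 - Γ₅` vanishes. -/
theorem free_sub_conjTranspose_mulVec_eq_zero (φ : TorusSite 4 N × Fin 3 × Fin 4 → ℂ)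
    (h0 : ∀ q, φ q ≠ 0 → q.2.2 = 0) (p : TorusSite 4 N × Fin 3 × Fin 4)
    (hpar : ∀ (μ : Fin 4) (β : Fin 4),
      φ (p.1 - Pi.single μ 1, p.2.1, β) = φ (p.1 + Pi.single μ 1, p.2.1, β)) :
    ((wilsonDirac (fundamentalRep (Fin 3)) (1 : GaugeConfig 4 N SU3) 0 1 -
        (wilsonDirac (fundamentalRep (Fin 3)) (1 : GaugeConfig 4 N SU3) 0 1)ᴴ) *ᵥ φ) p = 0 := by
  set D := wilsonDirac (fundamentalRep (Fin 3)) (1 : GaugeConfig 4 N SU3) 0 1 with hD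
  have hΓ : spinorLift gammaFive *ᵥ φ = φ :=
    (spinorLift_gammaFive_mulVec_eq_self_iff φ).2 fun q hq => by rw [h0 q hq]; decide
  have hH : spinorLift gammaFive * D * spinorLift gammaFive = Dᴴ :=
    wilsonDirac_gammaFive_hermitian_holds (fundamentalRep (Fin 3)) fundamentalRep_mem_unitaryGroup _ 0 1
  have hDφ : (D *ᵥ φ) p = 4 * φ p - ∑ μ, φ (p.1 + Pi.single μ 1, p.2.1, p.2.2) := by
    rw [hD, wilsonDirac_one_mulVec_apply]
    simp_rw [hpar, sum_projMinus_add_projPlus, ← Finset.mul_sum]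
    push_cast
    ring
  have hz : p.2.2 ≠ 0 → (D *ᵥ φ) p = 0 := fun hp => by
    have h1 : ∀ (z : TorusSite 4 N) (a : Fin 3), φ (z, a, p.2.2) = 0 := fun z a => by
      by_contra h
      have h' := h0 (z, a, p.2.2) h
      exact hp h'
    rw [hDφ]
    obtain ⟨y, a, α⟩ := p
    simp [h1]
  rw [Matrix.sub_mulVec, Pi.sub_apply, ← hH, ← Matrix.mulVec_mulVec, ← Matrix.mulVec_mulVec, hΓ,
    spinorLift_gammaFive_mulVec]
  by_cases hp : p.2.2 = 0
  · rw [hp]; simp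
  · rw [hz hp]; simp

/-! ### The parity lemma on an even box -/

/-- **Parity lemma.** In the corner-`0` open box of EVEN side `ρ < N` (no wrap-around), for a site
`y` of the box and a direction `μ`, the backward neighbour `y - e_μ` is an all-odd site of the box
iff the forward neighbour `y + e_μ` is: both say "`y_μ` is even and the other coordinates of `y` are
odd", because an even `y_μ ∈ (0, ρ)` has `2 ≤ y_μ ≤ ρ - 2`. -/
theorem oddSite_shift_iff {ρ : ℕ} (hρ : Even ρ) (hρN : ρ < N) (y : TorusSite 4 N)
    (hy : ∀ i, 0 < (y i).val ∧ (y i).val < ρ) (μ : Fin 4) :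
    (∀ i, 0 < ((y - Pi.single μ 1 : TorusSite 4 N) i).val ∧
        ((y - Pi.single μ 1 : TorusSite 4 N) i).val < ρ ∧
        ((y - Pi.single μ 1 : TorusSite 4 N) i).val % 2 = 1) ↔
      (∀ i, 0 < ((y + Pi.single μ 1 : TorusSite 4 N) i).val ∧
        ((y + Pi.single μ 1 : TorusSite 4 N) i).val < ρ ∧
        ((y + Pi.single μ 1 : TorusSite 4 N) i).val % 2 = 1) := by
  have h1 : (1 : ZMod N).val = 1 := ZMod.val_one'' (by have := hy 0; omega)
  have hplus : ∀ i, ((y + Pi.single μ 1 : TorusSite 4 N) i).val =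
      if i = μ then (y μ).val + 1 else (y i).val := by
    intro i
    by_cases hi : i = μ
    · subst hi
      rw [if_pos rfl, Pi.add_apply, Pi.single_eq_same, ZMod.val_add_of_lt, h1]
      rw [h1]; have := hy i; omega
    · rw [if_neg hi, Pi.add_apply, Pi.single_eq_of_ne hi, add_zero]
  have hminus : ∀ i, ((y - Pi.single μ 1 : TorusSite 4 N) i).val =
      if i = μ then (y μ).val - 1 else (y i).val := by
    intro i
    by_cases hi : i = μ
    · subst hi
      rw [if_pos rfl, Pi.sub_apply, Pi.single_eq_same, ZMod.val_sub, h1]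
      rw [h1]; exact (hy i).1
    · rw [if_neg hi, Pi.sub_apply, Pi.single_eq_of_ne hi, sub_zero]
  simp only [hplus, hminus]
  obtain ⟨k, hk⟩ := hρ
  refine forall_congr' fun i => ?_
  by_cases hi : i = μ
  · subst hi
    simp only [if_true]
    have := hy i
    omega
  · simp only [if_neg hi]

/-! ### The seed of the flat field -/

/-- **The staggered doubler vector is an exact kernel vector of `C − Cᴴ` for the flat field** on the
corner-`0` box of even sides `ρ ≥ 2` (torus side `N > ρ`): hence a seed at every tolerance `ε ≥ 0`. -/
theorem seed_one {ρ : ℕ} (hρ2 : 2 ≤ ρ) (hρ : Even ρ) (hρN : ρ < N) (ε : ℝ) (hε : 0 ≤ ε) :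
    ∃ ψ : {p // wilsonBox (0 : TorusSite 4 N) (fun _ => ρ) p} → ℂ, ψ ≠ 0 ∧
      ∑ p, ‖((wilsonCell (1 : GaugeConfig 4 N SU3) 0 0 (fun _ => ρ) -
        (wilsonCell (1 : GaugeConfig 4 N SU3) 0 0 (fun _ => ρ))ᴴ) *ᵥ ψ) p‖ ^ 2 ≤
        ε * ∑ p, ‖ψ p‖ ^ 2 := by
  -- the staggered vector on the whole torus: `1` on the all-odd sites of the open box, colour `0`, spin `0`
  set φ : TorusSite 4 N × Fin 3 × Fin 4 → ℂ := fun q =>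
    if (∀ i, 0 < (q.1 i).val ∧ (q.1 i).val < ρ ∧ (q.1 i).val % 2 = 1) ∧ q.2.1 = 0 ∧ q.2.2 = 0
    then 1 else 0 with hφ
  have hbox : ∀ q : TorusSite 4 N × Fin 3 × Fin 4,
      wilsonBox (0 : TorusSite 4 N) (fun _ => ρ) q ↔ ∀ i, 0 < (q.1 i).val ∧ (q.1 i).val < ρ := by
    intro q; simp [wilsonBox]
  have hoff : ∀ q, ¬ wilsonBox (0 : TorusSite 4 N) (fun _ => ρ) q → φ q = 0 := by
    intro q hq
    rw [hbox] at hq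
    simp only [hφ]
    rw [if_neg]
    rintro ⟨h, -, -⟩
    exact hq fun i => ⟨(h i).1, (h i).2.1⟩
  have h0 : ∀ q, φ q ≠ 0 → q.2.2 = 0 := by
    intro q hq
    by_contra h
    apply hq
    simp only [hφ]
    rw [if_neg]
    rintro ⟨-, -, h'⟩
    exact h h'
  have h1 : (1 : ZMod N).val = 1 := ZMod.val_one'' (by omega)
  refine ⟨fun p => φ p.1, ?_, ?_⟩
  · -- nonzero at the all-ones site
    intro hzero
    have hmem : wilsonBox (0 : TorusSite 4 N) (fun _ => ρ)
        (fun _ => (1 : ZMod N), (0 : Fin 3), (0 : Fin 4)) := by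
      rw [hbox]; intro i; simp only [h1]; omega
    have hc : (∀ i : Fin 4, 0 < ((fun _ : Fin 4 => (1 : ZMod N)) i).val ∧
        ((fun _ : Fin 4 => (1 : ZMod N)) i).val < ρ ∧
        ((fun _ : Fin 4 => (1 : ZMod N)) i).val % 2 = 1) ∧ (0 : Fin 3) = 0 ∧ (0 : Fin 4) = 0 :=
      ⟨fun _ => ⟨by simp [h1], by simp only [h1]; omega, by simp [h1]⟩, rfl, rfl⟩
    have hval : φ (fun _ => (1 : ZMod N), (0 : Fin 3), (0 : Fin 4)) = 1 := by
      rw [hφ]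
      exact if_pos hc
    have := congr_fun hzero ⟨_, hmem⟩
    simp only [Pi.zero_apply] at this
    rw [hval] at this
    exact one_ne_zero this
  · -- an exact kernel vector
    have hker : ∀ p : {p // wilsonBox (0 : TorusSite 4 N) (fun _ => ρ) p},
        ((wilsonCell (1 : GaugeConfig 4 N SU3) 0 0 (fun _ => ρ) -
          (wilsonCell (1 : GaugeConfig 4 N SU3) 0 0 (fun _ => ρ))ᴴ) *ᵥ fun q => φ q.1) p = 0 := by
      intro p
      rw [cell_sub_conjTranspose_mulVec _ _ _ _ φ hoff p]
      refine free_sub_conjTranspose_mulVec_eq_zero φ h0 p.1 fun μ β => ?_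
      have hy : ∀ i, 0 < (p.1.1 i).val ∧ (p.1.1 i).val < ρ := (hbox p.1).1 p.2
      simp only [hφ, oddSite_shift_iff hρ hρN p.1.1 hy μ]
    simp only [hker, norm_zero]
    simp only [ne_eq, OfNat.ofNat_ne_zero, not_false_eq_true, zero_pow, Finset.sum_const_zero]
    positivity

/-! ### The refutation -/

/-- **No zero-mode action floor (parametric form).**  For every floor `A₀ > 0`, tolerance `η₀`
and onset `ρ₀`, the implication "`(2η₀/ρ)`-seed of the flowed field in a `ρ`-box ⇒ flowed plaquette
action `≥ A₀` in the concentric `5ρ`-box" FAILS: witness the flat field `U = 1` (stationary under the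
flow, zero action) on the torus of side `8ρ + 1`, the even scale `ρ = 2(⌈ρ₀⌉₊ + 1) ≥ ρ₀`, the
corner-`0` box of sides `r ≡ ρ` and the staggered doubler vector (`seed_one`). -/
theorem seedActionFloor_false_at (A₀ η₀ ρ₀ : ℝ) (hA₀ : 0 < A₀) :
    ¬ (∀ (N : ℕ) [NeZero N] (U : GaugeConfig 4 N SU3) (ρ : ℕ), ρ₀ ≤ (ρ : ℝ) → 8 * ρ < N → ∀ (x : TorusSite 4 N) (r : Fin 4 → ℕ), (∀ i, r i ≤ ρ ∧ ρ ≤ 2 * r i) → (∃ ψ : {p // wilsonBox x r p} → ℂ, ψ ≠ 0 ∧ ∑ p, ‖((wilsonCell (wilsonFlow ((ρ : ℝ) ^ 2 / 8) U) 0 x r - (wilsonCell (wilsonFlow ((ρ : ℝ) ^ 2 / 8) U) 0 x r)ᴴ) *ᵥ ψ) p‖ ^ 2 ≤ (2 * η₀ / ρ) ^ 2 * ∑ p, ‖ψ p‖ ^ 2) → A₀ ≤ ∑ y : TorusSite 4 N, if siteBox (fun i => x i - ((2 * ρ : ℕ) : ZMod N)) (fun _ => 5 * ρ) y then ∑ μ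 : Fin 4, ∑ ν : Fin 4, (if μ < ν then (3 - ((fundamentalRep (Fin 3) (plaquetteHolonomy (wilsonFlow ((ρ : ℝ) ^ 2 / 8) U) y μ ν)).trace).re) else 0) else 0) := by
  intro h
  set ρ : ℕ := 2 * (⌈ρ₀⌉₊ + 1) with hρdef
  have hρ2 : 2 ≤ ρ := by omega
  have hρeven : Even ρ := even_two_mul _
  have hρ₀ : ρ₀ ≤ (ρ : ℝ) := by
    have h1 := Nat.le_ceil ρ₀
    have h2 : ((⌈ρ₀⌉₊ : ℕ) : ℝ) ≤ (ρ : ℝ) := by exact_mod_cast (by omega : ⌈ρ₀⌉₊ ≤ ρ)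
    exact h1.trans h2
  haveI : NeZero (8 * ρ + 1) := ⟨by omega⟩
  have hseed : ∃ ψ : {p // wilsonBox (0 : TorusSite 4 (8 * ρ + 1)) (fun _ => ρ) p} → ℂ, ψ ≠ 0 ∧
      ∑ p, ‖((wilsonCell (wilsonFlow ((ρ : ℝ) ^ 2 / 8) (1 : GaugeConfig 4 (8 * ρ + 1) SU3)) 0 0
          (fun _ => ρ) - (wilsonCell (wilsonFlow ((ρ : ℝ) ^ 2 / 8)
          (1 : GaugeConfig 4 (8 * ρ + 1) SU3)) 0 0 (fun _ => ρ))ᴴ) *ᵥ ψ) p‖ ^ 2 ≤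
        (2 * η₀ / ρ) ^ 2 * ∑ p, ‖ψ p‖ ^ 2 := by
    rw [wilsonFlow_one]
    exact seed_one hρ2 hρeven (by omega) _ (by positivity)
  have hmain := h (8 * ρ + 1) 1 ρ hρ₀ (by omega) 0 (fun _ => ρ) (fun _ => ⟨le_rfl, by omega⟩) hseed
  simp only [wilsonFlow_one, actionDensity_one, ite_self, Finset.sum_const_zero] at hmain
  exact absurd hmain (not_le.2 hA₀)

/-- **`stub_seedActionFloor` is FALSE** — the negation of the statement registered at
`Cruxes/NegativeCellsDilute`, line `price-the-seed-not-the-spot` (crux stmt-QuantumFields-13900),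
verbatim: no floor `A₀ > 16π²/9`, tolerance `η₀ > 0` and onset `ρ₀ > 0` make "naive-kernel seed of the
flowed field ⇒ flowed local action `≥ A₀`" hold for all `SU(3)` fields, because the flat field carries
an EXACT kernel vector of `C − Cᴴ` (a lattice doubler of the naive Dirac part on an even box) at zero
action.  The seed predicate of the line does not see the Wilson term that lifts the doublers. -/
theorem not_seedActionFloor :
    ¬ (∃ A₀ : ℝ, 16 * Real.pi ^ 2 / 9 < A₀ ∧ ∃ η₀ : ℝ, 0 < η₀ ∧ ∃ ρ₀ : ℝ, 0 < ρ₀ ∧ ∀ (N : ℕ) [NeZero N] (U : GaugeConfig 4 N SU3) (ρ : ℕ), ρ₀ ≤ (ρ : ℝ) → 8 * ρ < N → ∀ (x : TorusSite 4 N) (r : Fin 4 → ℕ), (∀ i, r i ≤ ρ ∧ ρ ≤ 2 * r i) → (∃ ψ : {p // wilsonBox x r p} → ℂ, ψ ≠ 0 ∧ ∑ p, ‖((wilsonCell (wilsonFlow ((ρ : ℝ) ^ 2 / 8) U) 0 x r - (wilsonCell (wilsonFlow ((ρ : ℝ) ^ 2 / 8) U) 0 x r)ᴴ) *ᵥ ψ)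 p‖ ^ 2 ≤ (2 * η₀ / ρ) ^ 2 * ∑ p, ‖ψ p‖ ^ 2) → A₀ ≤ ∑ y : TorusSite 4 N, if siteBox (fun i => x i - ((2 * ρ : ℕ) : ZMod N)) (fun _ => 5 * ρ) y then ∑ μ : Fin 4, ∑ ν : Fin 4, (if μ < ν then (3 - ((fundamentalRep (Fin 3) (plaquetteHolonomy (wilsonFlow ((ρ : ℝ) ^ 2 / 8) U) y μ ν)).trace).re) else 0) else 0) := by
  rintro ⟨A₀, hA₀, η₀, -, ρ₀, -, h⟩
  exact seedActionFloor_false_at A₀ η₀ ρ₀ (lt_trans (by positivity) hA₀) h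

end Summit.QuantumFields.QCD.Theorems.NegativeCellsDiluteSeedActionFloorFalse
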